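import Summits.HodgeConjecture.HodgeCM.Model.ArchSlotTypeLetters_1

/-! PORT of `HodgeCM/Model/ArchSlotTypeLetters.lean` (HodgeCMPerL run 82) — part 2: continuation of `Summits.HodgeConjecture.HodgeCM.Model.ArchSlotTypeLetters_1` (split at a top-level declaration boundary by port_pkg.py; scope re-opened below; declarations unchanged). -/

-- port_pkg: scope re-opened for this part (file-level context, then the namespace/section stack open at the cut)
set_option autoImplicit false
noncomputable section
open scoped Matrix Classical
open Literature.NumberTheory.Automorphic Literature.NumberTheory.Weil1964
open Literature.NumberTheory.GelbartRogawski1991.UnitaryDualPair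
open Literature.RepresentationTheory.CompactGroups
open HodgeCM.Adelic HodgeCM.PerL34
namespace HodgeCM.Model.ArchSideTerm
section Residual
variable {L : CMField} {ι₁ : L →+* ℂ} (V : HermSpace3 L ι₁) (c : SeesawCtx L)
variable
  (hGR : (cmSplittingDatum (L : Type) finProdFinEquiv (frameD V) (frameD_real V) (frameD_ne V) (dW c.D) (dW_real c.D) (dW_ne c.D)).CompatibleSplitting)
  (hGR₀ : (cmSplittingDatum (L : Type) (e₁) (frameD V) (frameD_real V) (frameD_ne V) (lineVec (L : Type) (dW c.D 0))
    (fun _ => dW_real c.D 0) (fun _ => dW_ne c.D 0)).CompatibleSplitting)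
  (hGR₁ : (cmSplittingDatum (L : Type) (e₁) (frameD V) (frameD_real V) (frameD_ne V) (lineVec (L : Type) (dW c.D 1))
    (fun _ => dW_real c.D 1) (fun _ => dW_ne c.D 1)).CompatibleSplitting)
  (hGR₂ : (cmSplittingDatum (L : Type) (e₁) (frameD V) (frameD_real V) (frameD_ne V) (lineVec (L : Type) (dW' c.D 0))
    (fun _ => dW'_real c.D 0) (fun _ => dW'_ne c.D 0)).CompatibleSplitting)
  (hGR₃ : (cmSplittingDatum (L : Type) (e₁) (frameD V) (frameD_real V) (frameD_ne V) (lineVec (L : Type) (dW' c.D 1))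
    (fun _ => dW'_real c.D 1) (fun _ => dW'_ne c.D 1)).CompatibleSplitting)
  (hpos₀ : 0 < HypCensus.cmXW (L : Type) (frameD V) (lineVec (L : Type) (dW c.D 0)) (fun _ => dW_real c.D 0) ι₁ (HypCensus.cmPlace (L : Type) ι₁) 0)
  (hpos₁ : 0 < HypCensus.cmXW (L : Type) (frameD V) (lineVec (L : Type) (dW c.D 1)) (fun _ => dW_real c.D 1) ι₁ (HypCensus.cmPlace (L : Type) ι₁) 0)
  (hpos₂ : 0 < HypCensus.cmXW (L : Type) (frameD V) (lineVec (L : Type) (dW' c.D 0)) (fun _ => dW'_real c.D 0) ι₁ (HypCensus.cmPlace (L : Type) ι₁) 0)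
  (hpos₃ : 0 < HypCensus.cmXW (L : Type) (frameD V) (lineVec (L : Type) (dW' c.D 1)) (fun _ => dW'_real c.D 1) ι₁ (HypCensus.cmPlace (L : Type) ι₁) 0)
  (h₁W : (∀ j, 0 < (ι₁ (dW c.D j)).re) ∨ ∀ j, (ι₁ (dW c.D j)).re < 0)
  {N₀ N₁ : ℕ} (hN₀ : N₀ ≠ 0) (hN₁ : N₁ ≠ 0) (w : NumberField.InfinitePlace (L : Type)) (a₀ a₁ a₂ a₃ : ℤ)
  (ha₀ : ∀ z : Circle,
    cmPairRep (L : Type) finProdFinEquiv (frameD V) (frameD_real V) (frameD_ne V) (dW c.D) (dW_real c.D) (dW_ne c.D) hGR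
        (1, cmPlaneTorusIdeles (L : Type) (dW c.D)
          (relNormOneInfToIdeles (↥(NumberField.maximalRealSubfield (L : Type))) (L : Type) (archCoord (L : Type) w z),
            relNormOneInfToIdeles (↥(NumberField.maximalRealSubfield (L : Type))) (L : Type) 1))
        (slotTensor V c.D hpos₀ hpos₁ N₀ N₁) =
      (((z ^ a₀ : Circle)) : ℂ) • slotTensor V c.D hpos₀ hpos₁ N₀ N₁)
  (ha₁ : ∀ z : Circle,
    cmPairRep (L : Type) finProdFinEquiv (frameD V) (frameD_real V) (frameD_ne V) (dW c.D) (dW_real c.D) (dW_ne c.D) hGR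
        (1, cmPlaneTorusIdeles (L : Type) (dW c.D)
          (relNormOneInfToIdeles (↥(NumberField.maximalRealSubfield (L : Type))) (L : Type) 1,
            relNormOneInfToIdeles (↥(NumberField.maximalRealSubfield (L : Type))) (L : Type) (archCoord (L : Type) w z)))
        (slotTensor V c.D hpos₀ hpos₁ N₀ N₁) =
      (((z ^ a₁ : Circle)) : ℂ) • slotTensor V c.D hpos₀ hpos₁ N₀ N₁)
  (ha₂ : ∀ z : Circle,
    cmPairRep (L : Type) finProdFinEquiv (frameD V) (frameD_real V) (frameD_ne V) (dW c.D) (dW_real c.D) (dW_ne c.D) hGR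
        (1, cmConjPlaneTorusIdeles (L : Type) (dW c.D) (dW' c.D) c.D.isoGL (isoGL_hg₀ c.D)
          (relNormOneInfToIdeles (↥(NumberField.maximalRealSubfield (L : Type))) (L : Type) (archCoord (L : Type) w z),
            relNormOneInfToIdeles (↥(NumberField.maximalRealSubfield (L : Type))) (L : Type) 1))
        (conjSlotTensor V c.D hpos₂ hpos₃ N₀ N₁) =
      (((z ^ a₂ : Circle)) : ℂ) • conjSlotTensor V c.D hpos₂ hpos₃ N₀ N₁)
  (ha₃ : ∀ z : Circle,
    cmPairRep (L : Type) finProdFinEquiv (frameD V) (frameD_real V) (frameD_ne V) (dW c.D) (dW_real c.D) (dW_ne c.D) hGR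
        (1, cmConjPlaneTorusIdeles (L : Type) (dW c.D) (dW' c.D) c.D.isoGL (isoGL_hg₀ c.D)
          (relNormOneInfToIdeles (↥(NumberField.maximalRealSubfield (L : Type))) (L : Type) 1,
            relNormOneInfToIdeles (↥(NumberField.maximalRealSubfield (L : Type))) (L : Type) (archCoord (L : Type) w z)))
        (conjSlotTensor V c.D hpos₂ hpos₃ N₀ N₁) =
      (((z ^ a₃ : Circle)) : ℂ) • conjSlotTensor V c.D hpos₂ hpos₃ N₀ N₁)

include hN₀ hN₁ ha₀ in
/-- **`slotTypeVec 0 w` = the exponent of the letter `(1,(ι_w(z),1))` on the slot tensor.** -/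
theorem slotTypeVec_zero_eq_of_letter : slotTypeVec V c hGR hGR₀ hGR₁ hGR₂ hGR₃ h₁W 0 w = a₀ :=
  slotType₀_eq_of_letter V c.D hGR hGR₀ hGR₁ hpos₀ hpos₁ h₁W hN₀ hN₁ w a₀ ha₀

include hN₀ hN₁ ha₁ in
/-- **`slotTypeVec 1 w` = the exponent of the letter `(1,(1,ι_w(z)))` on the slot tensor.** -/
theorem slotTypeVec_one_eq_of_letter : slotTypeVec V c hGR hGR₀ hGR₁ hGR₂ hGR₃ h₁W 1 w = a₁ :=
  slotType₁_eq_of_letter V c.D hGR hGR₀ hGR₁ hpos₀ hpos₁ h₁W hN₀ hN₁ w a₁ ha₁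

include hN₀ hN₁ ha₂ in
/-- **`slotTypeVec 2 w` = the exponent of the conjugated letter `(1, g₀(ι_w(z),1)g₀⁻¹)` on the conjugated slot tensor.** -/
theorem slotTypeVec_two_eq_of_letter : slotTypeVec V c hGR hGR₀ hGR₁ hGR₂ hGR₃ h₁W 2 w = a₂ :=
  slotType₂_eq_of_letter V c.D hGR hGR₂ hGR₃ hpos₂ hpos₃ h₁W hN₀ hN₁ w a₂ ha₂

include hN₀ hN₁ ha₃ in
/-- **`slotTypeVec 3 w` = the exponent of the conjugated letter `(1, g₀(1,ι_w(z))g₀⁻¹)` on the conjugated slot tensor.** -/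
theorem slotTypeVec_three_eq_of_letter : slotTypeVec V c hGR hGR₀ hGR₁ hGR₂ hGR₃ h₁W 3 w = a₃ :=
  slotType₃_eq_of_letter V c.D hGR hGR₂ hGR₃ hpos₂ hpos₃ h₁W hN₀ hN₁ w a₃ ha₃

include hN₀ hN₁ ha₀ ha₁ in
/-- **(J-μ)₁ IN LETTER FORM**: `slotTypeVec 1 w − slotTypeVec 0 w = a₁ − a₀`. -/
theorem slotTypeVec_one_sub_zero_eq_of_letters :
    slotTypeVec V c hGR hGR₀ hGR₁ hGR₂ hGR₃ h₁W 1 w - slotTypeVec V c hGR hGR₀ hGR₁ hGR₂ hGR₃ h₁W 0 w = a₁ - a₀ := by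
  rw [slotTypeVec_one_eq_of_letter V c hGR hGR₀ hGR₁ hGR₂ hGR₃ hpos₀ hpos₁ h₁W hN₀ hN₁ w a₁ ha₁,
    slotTypeVec_zero_eq_of_letter V c hGR hGR₀ hGR₁ hGR₂ hGR₃ hpos₀ hpos₁ h₁W hN₀ hN₁ w a₀ ha₀]

include hN₀ hN₁ ha₀ ha₂ in
/-- **(J-μ)₂ IN LETTER FORM**: `slotTypeVec 2 w − slotTypeVec 0 w = a₂ − a₀`. -/
theorem slotTypeVec_two_sub_zero_eq_of_letters :
    slotTypeVec V c hGR hGR₀ hGR₁ hGR₂ hGR₃ h₁W 2 w - slotTypeVec V c hGR hGR₀ hGR₁ hGR₂ hGR₃ h₁W 0 w = a₂ - a₀ := by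
  rw [slotTypeVec_two_eq_of_letter V c hGR hGR₀ hGR₁ hGR₂ hGR₃ hpos₂ hpos₃ h₁W hN₀ hN₁ w a₂ ha₂,
    slotTypeVec_zero_eq_of_letter V c hGR hGR₀ hGR₁ hGR₂ hGR₃ hpos₀ hpos₁ h₁W hN₀ hN₁ w a₀ ha₀]

include hN₀ hN₁ ha₀ ha₃ in
/-- **(J-μ)₃ IN LETTER FORM**: `slotTypeVec 3 w − slotTypeVec 0 w = a₃ − a₀`. -/
theorem slotTypeVec_three_sub_zero_eq_of_letters :
    slotTypeVec V c hGR hGR₀ hGR₁ hGR₂ hGR₃ h₁W 3 w - slotTypeVec V c hGR hGR₀ hGR₁ hGR₂ hGR₃ h₁W 0 w = a₃ - a₀ := by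
  rw [slotTypeVec_three_eq_of_letter V c hGR hGR₀ hGR₁ hGR₂ hGR₃ hpos₂ hpos₃ h₁W hN₀ hN₁ w a₃ ha₃,
    slotTypeVec_zero_eq_of_letter V c hGR hGR₀ hGR₁ hGR₂ hGR₃ hpos₀ hpos₁ h₁W hN₀ hN₁ w a₀ ha₀]

end Residual

end HodgeCM.Model.ArchSideTerm

end
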